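/-
Origin: expansion seat `prover-pub-hodgecm-mc-sinst-1-g8-0`, handover #1235 2026-08-20T18:37Z md5 ddd98c10087c (110 l.; NEW additive leaf, ns HodgeCM.Model.ThetaSpace; imports #1234 + Model/ThetaSpaceSatTranslate only; (J4) form side, UNCONDITIONAL half: `forall_conj_mem_of_le_normalCore`, `exists_mem_thetaSpaceSatOf_coe_eq_heckeWFun` (T_g maps the KΓ-saturated theta space of level Δ into the K''-saturated theta space of a common level N — level pair MOVED (Δ,KΓ) ↦ (N,K'')), `exists_mem_thetaSpaceSatOf_apply_eq_heckeW`; NAME LIST: HodgeCM.Model.ThetaSpace.forall_conj_mem_of_le_normalCore · HodgeCM.Model.ThetaSpace.exists_mem_thetaSpaceSatOf_coe_eq_heckeWFun · HodgeCM.Model.ThetaSpace.exists_mem_thetaSpaceSatOf_apply_eq_heckeW) (`HOME/mc/pub-hodgecm-mc-sinst-1-g8/stage/HodgeCM/Model/ThetaSpaceSatHeckeMoved.lean`, md5 ddd98c10087c, 110 lines);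
landed by the gen-24 packager (p-g24) in gate run 59 as `HodgeCM/Model/ThetaSpaceSatHeckeMoved.lean` (verbatim).
-/
/-
Copyright (c) 2026 the pub-hodgecm formalisation cell (harness21).  New file, not vendored.
Origin: session prover-pub-hodgecm-mc-sinst-1-g8-0 (unit pub-hodgecm-mc-sinst-1-g8, S-INSTANCE CONSTRUCTOR gen 8; section/adelic side of the
(J-Liu-Θ) junction behind E's row 9 `hΘ`, division of labour with binder-1-g15 STATUS 2026-08-20T18:25:02Z), 2026-08-20.
Intended final place: `HodgeCM/Model/ThetaSpaceSatHeckeMoved.lean` (NEW additive leaf; imports `HodgeCM.Model.WeightFormsHecke` and theta-3's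
`HodgeCM.Model.ThetaSpaceSatTranslate` only; nothing imports it; drop alone on bounce).
-/
import Summits.HodgeConjecture.HodgeCM.Model.WeightFormsHecke
import Summits.HodgeConjecture.HodgeCM.Model.ThetaSpaceSatTranslate

set_option autoImplicit false

/-!
# Saturated classical theta spaces under the Hecke operators, LEVEL PAIR MOVED ((J4), form side, unconditional half)

`Model/ThetaSpaceSatTranslate` (theta-3 ∕ period-1) proves that ONE rational left translate `x ↦ f (γ₁ x)` of a form of the
`KΓ`-saturated classical theta space of level `Δ` lies in the `KΓ'`-saturated theta space of any level `Δ'` with `γ₁ Δ' γ₁⁻¹ ⊆ Δ`,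
`k KΓ' k⁻¹ ⊆ KΓ` (`k` the finite-adelic corrector of `γ₁`).  The classical Hecke operator `T_g f = Σ_{γΔ'} f (g γ⁻¹ ·)`
(`WeightFormsHecke.heckeWFun`, `Δ' = Δ ∩ g⁻¹Δg`) is a finite sum of such translates by the rational representatives `g γ⁻¹` of `Δ g Δ`,
so — READ AT A COMMON LEVEL `N` normalised by all of them (e.g. the normal core of `Δ'` in `Δ`, `forall_conj_mem_of_le_normalCore`) and at a
finite level `K''` conjugated into `KΓ` by every corrector — **`T_g` maps the `KΓ`-saturated theta space of level `Δ` into the `K''`-saturated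
theta space of level `N`** (`exists_mem_thetaSpaceSatOf_coe_eq_heckeWFun`).  The level pair MOVES `(Δ, KΓ) ↦ (N, K'')`, exactly as for a
single translate; nothing better is claimed here (a level-`Δ` statement needs a `K`-type situation whose index group corrects all of `Δ` for
the SUM — theta-3's «Hecke-sum situation» `KTypeSituation.sumTranslateStrict` of the sibling `Model/ThetaSpaceSatHecke.lean`, which is
right-`KΓ`-saturated exactly under the coset-stability hypothesis (hQ) «the correctors `k_q` fill `KΓ k_g⁻¹ KΓ ⁄ KΓ`»; (hQ) is a class-number
condition on `(Δ, KΓ, g)` and is NOT automatic for a single double coset of `U(2,1)`, so the present LEVEL-MOVING statement is the unconditional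
half and the fixed-level statement the (hQ)-conditional half).
KERNEL only: 0 records, 0 `def … : Prop`, nothing cited, 0 proof holes; `#print axioms` ⊆ {propext, Classical.choice, Quot.sound}.
-/

noncomputable section

open MeasureTheory NumberField NumberField.mixedEmbedding IsDedekindDomain
open Literature.NumberTheory.Automorphic Literature.NumberTheory.Weil1964
open Literature.NumberTheory.Automorphic.WeightForms (restrictHom IsLevelCorrected IsWeightMatched)
open HodgeCM.PerL34.Seesaw HodgeCM.PerL34.RationalCoset HodgeCM.PerL34.SupplyAdelic
open HodgeCM.Model.SupplyInstance HodgeCM.Model.SupplyResidual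
open HodgeCM.BallFormsHecke (heckeStab mem_heckeStab_iff heckeStab_le)
open HodgeCM.WeightFormsHecke (heckeWFun heckeWFun_apply heckeW coe_heckeW)

namespace HodgeCM
namespace Model
namespace ThetaSpace

section SatHecke

variable {K L : Type} [Field K] [NumberField K] [Field L] [NumberField L] [Algebra K L] [FiniteDimensional K L]
variable {J : Type} [Fintype J] {GU : Type} [Group GU] [TopologicalSpace GU] [IsTopologicalGroup GU]
  [LocallyCompactSpace GU]
variable {P : WeilPairData K L J GU} [CompactSpace (GU ⧸ P.ΓU)]
variable {G₁ K₁ W : Type} [Group G₁] [Group K₁] [AddCommGroup W] [Module ℂ W] [Module.IsReflexive ℂ W]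
variable {ιinf : G₁ →* GU} {Δ N : Subgroup G₁} {κ₁ : K₁ →* G₁} {τ₁ : Representation ℂ K₁ W}

omit [Group K₁] in
/-- **The normal core is a common level for all representatives**: if `N ≤ Δ` and `N` (in `Δ`) lies in the normal core of
`Δ' = Δ ∩ g⁻¹Δg` in `Δ`, then `(g γ⁻¹) n (g γ⁻¹)⁻¹ ∈ Δ` for every `γ ∈ Δ`, `n ∈ N`. [folklore] -/
theorem forall_conj_mem_of_le_normalCore {g : G₁} (hNΔ : N ≤ Δ)
    (hN : N.subgroupOf Δ ≤ ((heckeStab Δ g).subgroupOf Δ).normalCore) (γ : Δ) :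
    ∀ n ∈ N, g * ((γ : G₁))⁻¹ * n * (g * ((γ : G₁))⁻¹)⁻¹ ∈ Δ := by
  intro n hn
  have hn' : (⟨n, hNΔ hn⟩ : Δ) ∈ ((heckeStab Δ g).subgroupOf Δ).normalCore :=
    hN (by simpa [Subgroup.mem_subgroupOf] using hn)
  have hconj : γ⁻¹ * ⟨n, hNΔ hn⟩ * γ⁻¹⁻¹ ∈ ((heckeStab Δ g).subgroupOf Δ).normalCore :=
    (Subgroup.normalCore_normal _).conj_mem _ hn' γ⁻¹
  have hmem : ((γ : G₁))⁻¹ * n * (γ : G₁) ∈ heckeStab Δ g := by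
    simpa [Subgroup.mem_subgroupOf] using Subgroup.normalCore_le _ hconj
  have := (mem_heckeStab_iff.mp hmem).2
  rw [show g * ((γ : G₁))⁻¹ * n * (g * ((γ : G₁))⁻¹)⁻¹ = g * (((γ : G₁))⁻¹ * n * (γ : G₁)) * g⁻¹ by group]
  exact this

/-- **Hecke images of saturated theta forms, level pair moved** ((J4), form side): for `g ∈ G₁` with `Δ' = Δ ∩ g⁻¹Δg` of finite index,
rational representatives `g (out q)⁻¹` with finite-adelic correctors `k q` (`ιinf (g (out q)⁻¹) · k q ∈ P.ΓU`, `k q` centralising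
`ιinf (G₁)` — from `WeightFormsHecke.exists_corrector_mul_inv` at the pin), a common level `N` (`(g (out q)⁻¹) N (g (out q)⁻¹)⁻¹ ⊆ Δ` for all `q`,
e.g. `forall_conj_mem_of_le_normalCore`) and a finite level `K''` with `k q · K'' · (k q)⁻¹ ⊆ KΓ` for all `q`: every `f` of the `KΓ`-saturated
classical theta space of level `Δ` has `T_g f = Σ_q f (g (out q)⁻¹ ·)` (as a function on `G₁`) in the `K''`-saturated classical theta space of
level `N`. -/
theorem exists_mem_thetaSpaceSatOf_coe_eq_heckeWFun {KΓ K'' : Subgroup GU} {g : G₁}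
    [Fintype (Δ ⧸ (heckeStab Δ g).subgroupOf Δ)] (k : Δ ⧸ (heckeStab Δ g).subgroupOf Δ → GU)
    (hk : ∀ q : Δ ⧸ (heckeStab Δ g).subgroupOf Δ, ιinf (g * (((Quotient.out q : Δ) : G₁))⁻¹) * k q ∈ P.ΓU) (hkc : ∀ q (x : G₁), Commute (k q) (ιinf x))
    (hN : ∀ q : Δ ⧸ (heckeStab Δ g).subgroupOf Δ, ∀ n ∈ N, g * (((Quotient.out q : Δ) : G₁))⁻¹ * n * (g * (((Quotient.out q : Δ) : G₁))⁻¹)⁻¹ ∈ Δ)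
    (hK : ∀ q, ∀ a ∈ K'', k q * a * (k q)⁻¹ ∈ KΓ) (𝓕 : Set C(relNormOneIdeles K L ⧸ relNormOneRat K L, ℂ))
    {f : weightForms Δ κ₁ τ₁} (hf : f ∈ thetaSpaceSatOf P ιinf Δ κ₁ τ₁ KΓ 𝓕) :
    ∃ f' ∈ thetaSpaceSatOf P ιinf N κ₁ τ₁ K'' 𝓕, (f' : G₁ → W) = heckeWFun Δ g (f : G₁ → W) := by
  classical
  choose F hF hFeq using fun q =>
    exists_mem_thetaSpaceSatOf_coe_eq_leftTranslate (Δ' := N) (hk q) (hkc q) (hN q) (hK q) 𝓕 hf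
  refine ⟨∑ q, F q, Submodule.sum_mem _ fun q _ => hF q, ?_⟩
  funext x
  rw [heckeWFun_apply, Submodule.coe_sum, Finset.sum_apply]
  exact Finset.sum_congr rfl fun q _ => by rw [hFeq q]

/-- The same with the sum READ BACK AT LEVEL `Δ` as the weight form `heckeW … Δ g f` and restricted to `N ≤ Δ`: its values agree with an element
of the `K''`-saturated theta space of level `N` (pointwise form, the shape `Model/HStabDischarge` consumes). -/
theorem exists_mem_thetaSpaceSatOf_apply_eq_heckeW {KΓ K'' : Subgroup GU} {g : G₁}
    [Fintype (Δ ⧸ (heckeStab Δ g).subgroupOf Δ)] (k : Δ ⧸ (heckeStab Δ g).subgroupOf Δ → GU)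
    (hk : ∀ q : Δ ⧸ (heckeStab Δ g).subgroupOf Δ, ιinf (g * (((Quotient.out q : Δ) : G₁))⁻¹) * k q ∈ P.ΓU) (hkc : ∀ q (x : G₁), Commute (k q) (ιinf x))
    (hN : ∀ q : Δ ⧸ (heckeStab Δ g).subgroupOf Δ, ∀ n ∈ N, g * (((Quotient.out q : Δ) : G₁))⁻¹ * n * (g * (((Quotient.out q : Δ) : G₁))⁻¹)⁻¹ ∈ Δ)
    (hK : ∀ q, ∀ a ∈ K'', k q * a * (k q)⁻¹ ∈ KΓ) (𝓕 : Set C(relNormOneIdeles K L ⧸ relNormOneRat K L, ℂ))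
    {f : weightForms Δ κ₁ τ₁} (hf : f ∈ thetaSpaceSatOf P ιinf Δ κ₁ τ₁ KΓ 𝓕) :
    ∃ f' ∈ thetaSpaceSatOf P ιinf N κ₁ τ₁ K'' 𝓕, ∀ x : G₁, (f' : G₁ → W) x = (heckeW κ₁ τ₁ Δ g f : G₁ → W) x := by
  obtain ⟨f', hf', he⟩ := exists_mem_thetaSpaceSatOf_coe_eq_heckeWFun k hk hkc hN hK 𝓕 hf
  exact ⟨f', hf', fun x => by rw [he, coe_heckeW]⟩

end SatHecke

end ThetaSpace
end Model
end HodgeCM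

end
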